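import Mathlib
import Literature.MathematicalPhysics.QuantumFieldTheory.Balaban1983to89.T4ActivityTilt
import Literature.MathematicalPhysics.QuantumFieldTheory.Balaban1983to89.T4ActivityTiltPotential
import Literature.MathematicalPhysics.QuantumFieldTheory.Balaban1983to89.T4ActivityTiltHistory
import Literature.MathematicalPhysics.QuantumFieldTheory.Balaban1983to89.T4ActivityReach

/-!
# T⁴-continuum spine estimate NE5 (node U3), polymer-activity route — companion §15 of the TILT LEMMA: the TWO-SPECIES
# bound of a (2.14)-term WITHOUT ANY DISPLACED-ENDPOINT DATUM — the form domination (DOM) PRODUCED pointwise from the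
# reference run's kernels and the kernel displacements (§10's junction composed with the reach lemmas of §14), and the
# normalised two-run bound with the displaced majorants, normalisation and determinant channel all discharged [folklore]

Cell `pub-balaban`, T⁴-continuum fan-out, node U3 / estimate NE5, prover seat P2 (assigned technique: *polymer-activity
Lipschitz route — bound output differences by activity differences via the printed convergence criteria (Kotecký–Preiss
norm)*), lineage generation 14; FILE v1 (NEW LEAF, the fifth COMPANION MODULE of `T4ActivityTilt` v1.5 = p191365 — frozen
at the gate's size cap —; it imports `T4ActivityTilt`, `T4ActivityTiltPotential` v1, `T4ActivityTiltHistory` v1.0.1 and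
`T4ActivityReach` v1 and uses their declarations BY QUALIFIED / SELECTIVELY OPENED NAME; nothing of them is restated or
modified; THEOREMS ONLY, no `def`).  Honest frame of the whole cell unchanged: rung (B)+1 of a FINITE-VOLUME T⁴ programme;
NOT infinite volume, NOT a mass gap, NOT the Clay problem.  Nothing in this file is an estimate OF [Balaban1988RG2Cluster];
it is [folklore] bookkeeping (compositions of the lineage's own kernel-checked lemmas, finite sums, elementary real
inequalities), plus the dictionary of `T4ActivityTilt`'s header saying which printed ONE-run KIND of [Balaban1988RG2Cluster]
pp. 15–16 the hypothesis shapes read — every transposition of a ONE-run printed bound to the comparison of TWO runs being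
NOT PRINTED and flagged so.  ABSOLUTE RULE kept: every hypothesis of every theorem is an explicit binder; no
internally-minted statement, no programme-internal claim and no disputed step of the papers under audit is used as a fact;
no `BetaPertH`, (B) or (B^μ) is hidden in a definition (there is no definition in this file); tree declarations of other
seats are cited BY NAME only.

WHERE IT SITS.  The route's closure `T4ActivityThreshold.ne5_at_max_of_model_actLip₂_reach` (v1.1) consumes the two-species
regularity datum `T4ActivityRecursion.InputModel.ActivityLipschitz₂ W m Λop Λhist ρ₀` (v1.4 §9.2) — the lineage's wall
G-ne5p2-3′, NOT PRINTED —, and `T4ActivityThreshold.activityLipschitz₂_of_termSlots` reduces it to a per-term slot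
`‖T q − T p‖ ≤ (Λop·‖q.1 − p.1‖/ϱOp + Λhist·‖q.2 − p.2‖/ϱHist)·G` around every base point `p` within relative reach `ρ₀`.
`T4ActivityTiltHistory.twoSpecies_of_tilt_affine` (§12.4) gives that slot shape for a normalised tilted (2.14)-term, but
from hypotheses half of which concern the DISPLACED endpoint `q` (its tilted majorant `M_A`, its normalisation `z_A ≠ 0`,
its kernels' invertibility and decay), which in `ActivityLipschitz₂` is ARBITRARY within the reach and carries no data.
`T4ActivityReach` (§14) produced each displaced datum from REFERENCE data + a small displacement.  THIS FILE COMPOSES: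
  §15.1 the form domination (DOM) of `T4ActivityTilt` §8 PRODUCED POINTWISE from constituent data (§9.3's junction with
        its last step `norm_integral_tilt_sub_le_of_entryBounds` replaced by `norm_diffForm_le`; same hypotheses minus the
        measure-side ones, same constant: `norm_diffForm_le_of_constituentBounds`) and from resolvent data (§10's:
        `norm_diffForm_le_of_resolventBounds`) — the `hdomop` currency of the two-species composition;
  §15.2 (DOM) OF THE REACH: for the displaced kernels `L_B + E_L`, `A_B + E_A`, `P_B + E_P` against `L_B, A_B, P_B`, the
        pointwise domination from REFERENCE one-run data WITH ROOM (rates `2δ` / `δ`) and the displacement sizes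
        `r_L, r, r_P` under the reach conditions `c r K² < 1`, `c_P r_P K² < 1` — NO hypothesis on the displaced run
        (`norm_diffForm_le_of_reach`: §14's `resolvent_near` / `inv_near` supply §10's `hdA`/`hA`/`hRA`/`hCA`, both runs
        enter at common constants `m̄ ≥ m + r_L`, `c′ ≥ c/(1 − c r K²)`, `c_P′ ≥ c_P/(1 − c_P r_P K²)`); and with sizes
        LINEAR in one relative displacement `t ∈ [0, 1]` (`r_• = κ_• t`) the constant is `c_G·t`, `c_G` free of `t`
        (`norm_diffForm_le_of_reach_linear`);
  §15.3 the operator channel assembled with the potential channel of `T4ActivityTiltPotential` §11.2 under term rates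
        linear in `t`: `‖Δ_G + Δ_V‖ ≤ (c_G + κ_Q W K)t·domForm + (κ_R n₀K″)t` (`opDom_of_reach_linear`) — the linear
        moduli `ρ ≤ c_ρ δ_op`, `βop ≤ c_β δ_op` of §12.4, PRODUCED;
  §15.4 THE TWO-SPECIES BOUND OF THE REACH (`twoSpecies_of_reach`): `T4ActivityTiltHistory.norm_tiltedTerm_sub_le_
        twoSpecies` with the displaced (ROB) majorant (`M_A = e^{βop+βh}M′` by `majorant_transfer` from the reference
        majorant WITH ROOM `u′ ≥ u + ρ`), the displaced integrability (`integrable_tilted`), the displaced normalisation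
        `z_A ≠ 0`, `‖z_A‖ ≥ ‖z_B‖/2` and the determinant constant `ζ = 2E₀/‖z_B‖` (`det_of_reach`, reach `2E₀ ≤ ‖z_B‖`)
        ALL DISCHARGED — no hypothesis mentions the displaced endpoint; in reference units (`twoSpecies_of_reach_ref`); and
        with rate moduli linear in the two relative sizes the (9.3)-SHAPE `≤ Λop·G·δ_op + Λh·G·δ_h` with ENVELOPE
        `G = 2e^{β̄}M′/‖z_B‖` and moduli `Λop = (c_ρ + e u c_β)(2 + c_ζ)/(e u) + c_ζ`, `Λh = c_h(2 + c_ζ)`,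
        `c_ζ = 4c₀M₀′/(e u₀‖z_B‖)` — functions of REFERENCE one-run data and of the rate constants ALONE
        (`twoSpecies_of_reach_affine`, via `twoSpecies_of_tilt_affine` BY NAME);
  §15.5 THE WHOLE CHAIN in one theorem for the (2.14)-term shape (`termSlot_of_reach`): operator channel = Gaussian
        difference form of the displaced-vs-reference kernels + potential sum of the difference kernels, history channel
        bounded, normalisation tilt = the quadratic form of `E_P`; hypotheses = reference data with room, sizes and term
        rates linear in `t = δ_op`, uniform rooms/reach, measurability — none on the displaced endpoint; conclusion = the
        per-term `hslot` shape with explicit moduli;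
  §15.6 toy: every hypothesis of §15.2 inhabited on the `2 × 2` toy of `T4ActivityTilt` §10.1 with NO displaced datum.
NET for the wall (honest): after §14–§15 the per-term slot of `activityLipschitz₂_of_termSlots` follows from (i) ONE-run
data of printed KIND at the base point WITH ROOM (entry decay of `L`, of the resolvents of `A`, of `P⁻¹` at doubled rate;
absolute majorants at growth `u′ > u`, `u₀′ > u₀`; `2E₀ ≤ ‖z_B‖`) — candidates for `InputModel.Base`/`BaseMajorant` —,
(ii) the history bound `βh ≤ c_h δ_h` (§12, `norm_histPot_read_sub_le`, from (B13) (1.23)/(1.24) KIND), and (iii) the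
displacement sizes of the kernels and of the potential's term rates being LINEAR in `δ_op = ‖q.1 − p.1‖/ϱOp` — which is
a property of the NORM CHOSEN on the operator slot (a modelling decision of the term model, next step of the lineage) and,
for the ACTUAL two runs `𝐀` vs `𝐁` of (1.1)–(1.4), exactly the NOT-PRINTED two-spacing rate content of
`InputModel.OperatorRate` (NE2 ∧ NE3) and `InsertionRate`.  So the NOT-PRINTED content of the wall is RELOCATED to rate
data, as planned (record §5 (40)); it is not discharged, and nothing here claims it is.  Smallness census of this file:
`c κ_A K² < 1`, `c_P κ_P K² < 1` (§15.2), `2E₀ ≤ ‖z_B‖` and the rooms `u + ρ ≤ u′`, `u₀ + ρ₀ ≤ u₀′` (§15.4) — REACH /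
ROOM conditions (restrictions of `ρ₀` and of the admissible growth parameters), never conditions on print's constants.

DICTIONARY (which printed KIND the binders read; the transposition to two runs NOT PRINTED) = that of `T4ActivityTilt`'s
and `T4ActivityReach`'s headers, unchanged: `L, A, P` ↦ the constituents of the first quadratic form of (2.14)–(2.15)
(`Γ = L·A^{−1/2}` by (2.7), `P = C^{(k)}(Z₀, σ(Z))⁻¹`); entry decay `c e^{−δd}` ↦ the (2.16) KIND, p. 15 *"In the
expression on the right-hand side we replace the operators by the corresponding operators with σ(Z) = 0, 𝐔 = U, 𝐉 = 0,
and we estimate the error. For the quadratic form in the first exponential the difference is a quadratic form"* p. 16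
*"½⟨X, R₁X⟩, with matrix elements satisfying the bound"* (2.16) `|R₁(b, b′)| ≤ (O(1)e^{−1/3 δ₀M} + O(α₀ + α₁))
exp(−½δ₀|b₋ − b′₋|)`; normalisations ↦ p. 16 *"Similarly, the next Gaussian measure is replaced by the measure with the
new covariance, multiplied by a quotient of determinants, which can be estimated by (2.17)"* (ONE run against the
`σ(Z) = 0` reference; the two-run quotient NOT PRINTED); majorants `M′, M₀′` ↦ the (2.23)–(2.26) KIND; the potential
channel's `τ, Q, 𝐕″, w, v, K″` ↦ (2.18)–(2.20), (1.42) KIND as in `T4ActivityTiltPotential`'s header.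

PROVENANCE.  Cell journal `CLAIMS.log` (rotated 2026-08-19T18:57Z): this generation's claim `T4-U3.E-NE5-PROVE-P2n*`
(l.728), `T4ActivityReach` v1 LANDED l.846; record `t4/T4-EST-U3-NE5-P2.md` §0(u)/§5 (40); carver ruling T4-DAG v26 §8 Q31
(readings of B13 are binders, never cited facts; the wall stays NOT PRINTED) — complied with throughout.

VERSIONS.  v1 (gen 14): NEW LEAF — §15.1–§15.6 as above.
-/

noncomputable section

open MeasureTheory

namespace Literature.MathematicalPhysics.QuantumFieldTheory.Balaban1983to89.T4ActivityTermReach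

open Literature.MathematicalPhysics.QuantumFieldTheory.Balaban1983to89.T4ActivityTilt
  (diffForm domForm domForm_nonneg norm_diffForm_le entryBound_mono norm_sum_mul_le_of_decay sandwichKer mulKer sqrtKer
    norm_sandwichKer_sub_le norm_inv_sub_inv_entry_le norm_mulKer_sqrtKer_le norm_mulKer_sqrtKer_sub_le lorentz
    lorentz_nonneg lorentz_le_one norm_tiltedTerm_sub_le norm_div_norm_le_one_add dom₀_of_entryBound)
open Literature.MathematicalPhysics.QuantumFieldTheory.Balaban1983to89.T4ActivityTiltPotential
  (potSum potDom_of_termRates half_sum_sq_le_domForm dom_affine_of_channels)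
open Literature.MathematicalPhysics.QuantumFieldTheory.Balaban1983to89.T4ActivityTiltHistory
  (norm_tiltedTerm_sub_le_twoSpecies twoSpecies_of_tilt_affine)
open Literature.MathematicalPhysics.QuantumFieldTheory.Balaban1983to89.T4ActivityReach
  (inv_near resolvent_near det_of_reach majorant_transfer majorant_mono integrable_tilted self_le_div_one_sub
    norm_le_of_near)

variable {ι κ S Ω Ω₀ 𝒴 𝒞 : Type*} [Fintype ι] [Fintype κ]
variable {E : Type*} [NormedAddCommGroup E] [NormedSpace ℂ E]

/-! ## §15.1 The form domination (DOM) PRODUCED pointwise from constituent and resolvent data [folklore]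

`T4ActivityTilt` §9.3/§10 compose the constituent producers straight into the INTEGRAL bound of §8; the two-species
composition of `T4ActivityTiltHistory` §12.4 (`norm_tiltedTerm_sub_le_twoSpecies`) consumes instead the POINTWISE
domination `‖Δ_G(x)‖ ≤ ρ_G·domForm`.  The two theorems below are §9.3's and §10's junctions with the last step
(`norm_integral_tilt_sub_le_of_entryBounds`) replaced by `norm_diffForm_le`: same hypotheses minus the measure-side ones,
same constant. -/

/-- [folklore] (DOM) FROM CONSTITUENT DATA, pointwise: the constant of
`T4ActivityTilt.norm_integral_tilt_sub_le_of_constituentBounds` as a pointwise domination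
`‖diffForm R₁ R₂ R₃ X B‖ ≤ ρ·domForm X B`, `ρ = (2γc r_Γ + γ²(c r_P c K²))K²·K + r_P K + r_Γ K`. -/
theorem norm_diffForm_le_of_constituentBounds [DecidableEq κ]
    (d : S → S → ℝ) (hd0 : ∀ s t, 0 ≤ d s t) (hsymm : ∀ s t, d s t = d t s)
    (htri : ∀ s t w, d s w ≤ d s t + d t w) (p : ι → S) (q : κ → S)
    (ΓA ΓB : κ → ι → ℂ) (PA PB : Matrix κ κ ℂ) (hA : IsUnit PA.det) (hB : IsUnit PB.det)
    (R₁ : ι → ι → ℂ) (R₂ : κ → κ → ℂ) (R₃ : κ → ι → ℂ)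
    {γ c rΓ rP δ K : ℝ}
    (hγ : 0 ≤ γ) (hc : 0 ≤ c) (hrΓ : 0 ≤ rΓ) (hrP : 0 ≤ rP) (hδ : 0 ≤ δ) (hK0 : 0 ≤ K)
    (hΓA : ∀ a b, ‖ΓA a b‖ ≤ γ * Real.exp (-(δ * d (q a) (p b))))
    (hΓB : ∀ a b, ‖ΓB a b‖ ≤ γ * Real.exp (-(δ * d (q a) (p b))))
    (hCA : ∀ a a', ‖(PA⁻¹) a a'‖ ≤ c * Real.exp (-(δ * d (q a) (q a'))))
    (hCB : ∀ a a', ‖(PB⁻¹) a a'‖ ≤ c * Real.exp (-(δ * d (q a) (q a'))))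
    (hΓ : ∀ a b, ‖ΓA a b - ΓB a b‖ ≤ rΓ * Real.exp (-(δ * d (q a) (p b))))
    (hP : ∀ a a', ‖PA a a' - PB a a'‖ ≤ rP * Real.exp (-(δ * d (q a) (q a'))))
    (hR₁ : ∀ b b', R₁ b b' = sandwichKer ΓA (PA⁻¹ : Matrix κ κ ℂ) b b'
      - sandwichKer ΓB (PB⁻¹ : Matrix κ κ ℂ) b b')
    (hR₂ : ∀ a a', R₂ a a' = PA a a' - PB a a')
    (hR₃ : ∀ a b, R₃ a b = ΓA a b - ΓB a b)
    (hKι : ∀ s, ∑ b, Real.exp (-(δ / 4 * d s (p b))) ≤ K)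
    (hKκ : ∀ s, ∑ a, Real.exp (-(δ / 4 * d s (q a))) ≤ K) (X : ι → ℝ) (B : κ → ℝ) :
    ‖diffForm R₁ R₂ R₃ X B‖
      ≤ ((2 * γ * c * rΓ + γ ^ 2 * (c * rP * c * K ^ 2)) * K ^ 2 * K + rP * K + rΓ * K) * domForm X B := by
  have hδ2 : δ / 2 ≤ δ := by linarith
  have hδ4 : δ / 4 ≤ δ := by linarith
  have hrC : 0 ≤ c * rP * c * K ^ 2 := by positivity
  have hr₁ : 0 ≤ (2 * γ * c * rΓ + γ ^ 2 * (c * rP * c * K ^ 2)) * K ^ 2 := by positivity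
  have hKκ2 : ∀ s, ∑ a, Real.exp (-(δ / 2 * d s (q a))) ≤ K := fun s =>
    (Finset.sum_le_sum fun a _ => Real.exp_le_exp.mpr (by nlinarith [hd0 s (q a)])).trans (hKκ s)
  have hC : ∀ a a', ‖(PA⁻¹) a a' - (PB⁻¹) a a'‖
      ≤ c * rP * c * K ^ 2 * Real.exp (-(δ / 2 * d (q a) (q a'))) :=
    norm_inv_sub_inv_entry_le d hd0 htri q PA PB hA hB hc hrP hδ hCA hCB hP hKκ2
  have hΓA' : ∀ a b, ‖ΓA a b‖ ≤ γ * Real.exp (-(δ / 2 * d (q a) (p b))) := fun a b =>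
    entryBound_mono hγ hδ2 (hd0 _ _) (hΓA a b)
  have hΓB' : ∀ a b, ‖ΓB a b‖ ≤ γ * Real.exp (-(δ / 2 * d (q a) (p b))) := fun a b =>
    entryBound_mono hγ hδ2 (hd0 _ _) (hΓB a b)
  have hCA' : ∀ a a', ‖(PA⁻¹) a a'‖ ≤ c * Real.exp (-(δ / 2 * d (q a) (q a'))) := fun a a' =>
    entryBound_mono hc hδ2 (hd0 _ _) (hCA a a')
  have hCB' : ∀ a a', ‖(PB⁻¹) a a'‖ ≤ c * Real.exp (-(δ / 2 * d (q a) (q a'))) := fun a a' =>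
    entryBound_mono hc hδ2 (hd0 _ _) (hCB a a')
  have hΓ' : ∀ a b, ‖ΓA a b - ΓB a b‖ ≤ rΓ * Real.exp (-(δ / 2 * d (q a) (p b))) := fun a b =>
    entryBound_mono hrΓ hδ2 (hd0 _ _) (hΓ a b)
  have hKq : ∀ s, ∑ a, Real.exp (-(δ / 2 / 2 * d s (q a))) ≤ K := fun s => by
    rw [show δ / 2 / 2 = δ / 4 by ring]; exact hKκ s
  refine norm_diffForm_le R₁ R₂ R₃
    (fun b b' => Real.exp (-(δ / 4 * d (p b) (p b'))))
    (fun a a' => Real.exp (-(δ / 4 * d (q a) (q a'))))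
    (fun a b => Real.exp (-(δ / 4 * d (q a) (p b))))
    (r₁ := (2 * γ * c * rΓ + γ ^ 2 * (c * rP * c * K ^ 2)) * K ^ 2) (r₂ := rP) (r₃ := rΓ)
    (K₁ := K) (K₂ := K) (K₃ := K)
    hr₁ hrP hrΓ ?_ ?_ ?_ (fun _ _ => (Real.exp_pos _).le) (fun _ _ => (Real.exp_pos _).le)
    (fun _ _ => (Real.exp_pos _).le) ?_ ?_ ?_ ?_ ?_ ?_ hK0 hK0 X B
  · intro b b'
    rw [hR₁]
    have h := norm_sandwichKer_sub_le d hd0 hsymm htri p q ΓA ΓB (PA⁻¹ : Matrix κ κ ℂ)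
      (PB⁻¹ : Matrix κ κ ℂ) hγ hc hrΓ hrC (by positivity : (0 : ℝ) ≤ δ / 2) hΓA' hΓB' hCA' hCB' hΓ'
      hC hKq b b'
    rwa [show δ / 2 / 2 = δ / 4 by ring] at h
  · intro a a'
    rw [hR₂]
    exact entryBound_mono hrP hδ4 (hd0 _ _) (hP a a')
  · intro a b
    rw [hR₃]
    exact entryBound_mono hrΓ hδ4 (hd0 _ _) (hΓ a b)
  · exact fun b => hKι (p b)
  · intro b'
    calc ∑ b, Real.exp (-(δ / 4 * d (p b) (p b')))
        = ∑ b, Real.exp (-(δ / 4 * d (p b') (p b))) :=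
          Finset.sum_congr rfl fun b _ => by rw [hsymm (p b) (p b')]
      _ ≤ K := hKι (p b')
  · exact fun a => hKκ (q a)
  · intro a'
    calc ∑ a, Real.exp (-(δ / 4 * d (q a) (q a')))
        = ∑ a, Real.exp (-(δ / 4 * d (q a') (q a))) :=
          Finset.sum_congr rfl fun a _ => by rw [hsymm (q a) (q a')]
      _ ≤ K := hKκ (q a')
  · exact fun a => hKι (q a)
  · intro b
    calc ∑ a, Real.exp (-(δ / 4 * d (q a) (p b)))
        = ∑ a, Real.exp (-(δ / 4 * d (p b) (q a))) :=
          Finset.sum_congr rfl fun a _ => by rw [hsymm (q a) (p b)]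
      _ ≤ K := hKκ (p b)

/-- [folklore] (DOM) FROM RESOLVENT DATA, pointwise: the constant of
`T4ActivityTilt.norm_integral_tilt_sub_le_of_resolventBounds` (composite `Γ_• = L_•·A_•^{−1/2}`) as a pointwise
domination `‖diffForm R₁ R₂ R₃ X B‖ ≤ ρ·domForm X B` — the hypothesis `hdomop` (Gaussian part) of the two-species
composition `T4ActivityTiltHistory.norm_tiltedTerm_sub_le_twoSpecies`, PRODUCED. -/
theorem norm_diffForm_le_of_resolventBounds [DecidableEq ι] [DecidableEq κ]
    (d : S → S → ℝ) (hd0 : ∀ s t, 0 ≤ d s t) (hsymm : ∀ s t, d s t = d t s)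
    (htri : ∀ s t w, d s w ≤ d s t + d t w) (p : ι → S) (q : κ → S)
    (LA LB : κ → ι → ℂ) (AA AB : Matrix ι ι ℂ)
    (hdA : ∀ u : ℝ, IsUnit (((u ^ 2 : ℝ) : ℂ) • (1 : Matrix ι ι ℂ) + AA).det)
    (hdB : ∀ u : ℝ, IsUnit (((u ^ 2 : ℝ) : ℂ) • (1 : Matrix ι ι ℂ) + AB).det)
    (PA PB : Matrix κ κ ℂ) (hA : IsUnit PA.det) (hB : IsUnit PB.det)
    (R₁ : ι → ι → ℂ) (R₂ : κ → κ → ℂ) (R₃ : κ → ι → ℂ)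
    {m rL a c r cP rP δ K : ℝ}
    (hm : 0 ≤ m) (hrL : 0 ≤ rL) (ha : 0 < a) (hc : 0 ≤ c) (hr : 0 ≤ r) (hcP : 0 ≤ cP)
    (hrP : 0 ≤ rP) (hδ : 0 ≤ δ) (hK0 : 0 ≤ K)
    (hLA : ∀ a' i, ‖LA a' i‖ ≤ m * Real.exp (-(δ * d (q a') (p i))))
    (hLB : ∀ a' i, ‖LB a' i‖ ≤ m * Real.exp (-(δ * d (q a') (p i))))
    (hL : ∀ a' i, ‖LA a' i - LB a' i‖ ≤ rL * Real.exp (-(δ * d (q a') (p i))))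
    (hRA : ∀ v i j, ‖T4ActivityTilt.resolvent AA v i j‖ ≤ c * lorentz a v * Real.exp (-(δ * d (p i) (p j))))
    (hRB : ∀ v i j, ‖T4ActivityTilt.resolvent AB v i j‖ ≤ c * lorentz a v * Real.exp (-(δ * d (p i) (p j))))
    (hAB : ∀ i j, ‖AA i j - AB i j‖ ≤ r * Real.exp (-(δ * d (p i) (p j))))
    (hCA : ∀ a' a'', ‖(PA⁻¹) a' a''‖ ≤ cP * Real.exp (-(δ / 2 * d (q a') (q a''))))
    (hCB : ∀ a' a'', ‖(PB⁻¹) a' a''‖ ≤ cP * Real.exp (-(δ / 2 * d (q a') (q a''))))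
    (hP : ∀ a' a'', ‖PA a' a'' - PB a' a''‖ ≤ rP * Real.exp (-(δ / 2 * d (q a') (q a''))))
    (hR₁ : ∀ b b', R₁ b b' = sandwichKer (mulKer LA (sqrtKer AA)) (PA⁻¹ : Matrix κ κ ℂ) b b'
      - sandwichKer (mulKer LB (sqrtKer AB)) (PB⁻¹ : Matrix κ κ ℂ) b b')
    (hR₂ : ∀ a' a'', R₂ a' a'' = PA a' a'' - PB a' a'')
    (hR₃ : ∀ a' b, R₃ a' b = mulKer LA (sqrtKer AA) a' b - mulKer LB (sqrtKer AB) a' b)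
    (hK2 : ∀ s, ∑ b, Real.exp (-(δ / 2 * d s (p b))) ≤ K)
    (hKι : ∀ s, ∑ b, Real.exp (-(δ / 8 * d s (p b))) ≤ K)
    (hKκ : ∀ s, ∑ a', Real.exp (-(δ / 8 * d s (q a'))) ≤ K) (X : ι → ℝ) (B : κ → ℝ) :
    ‖diffForm R₁ R₂ R₃ X B‖
      ≤ ((2 * (m * (c * Real.sqrt a) * K) * cP
              * ((rL * (c * Real.sqrt a) + m * (c ^ 2 * Real.sqrt a * r * K ^ 2)) * K)
            + (m * (c * Real.sqrt a) * K) ^ 2 * (cP * rP * cP * K ^ 2)) * K ^ 2 * K + rP * K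
            + (rL * (c * Real.sqrt a) + m * (c ^ 2 * Real.sqrt a * r * K ^ 2)) * K * K) * domForm X B :=
  norm_diffForm_le_of_constituentBounds d hd0 hsymm htri p q
    (mulKer LA (sqrtKer AA)) (mulKer LB (sqrtKer AB)) PA PB hA hB R₁ R₂ R₃
    (δ := δ / 2) (γ := m * (c * Real.sqrt a) * K) (c := cP)
    (rΓ := (rL * (c * Real.sqrt a) + m * (c ^ 2 * Real.sqrt a * r * K ^ 2)) * K)
    (by positivity) hcP (by positivity) hrP (by positivity) hK0
    (norm_mulKer_sqrtKer_le d hd0 htri q p LA AA hm ha hc hδ hLA hRA hK2)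
    (norm_mulKer_sqrtKer_le d hd0 htri q p LB AB hm ha hc hδ hLB hRB hK2)
    hCA hCB
    (norm_mulKer_sqrtKer_sub_le d hd0 htri q p LA LB AA AB hdA hdB hm hrL ha hc hr hδ hLB hL hRA hRB
      hAB hK2)
    hP hR₁ hR₂ hR₃
    (fun s => by rw [show δ / 2 / 4 = δ / 8 by ring]; exact hKι s)
    (fun s => by rw [show δ / 2 / 4 = δ / 8 by ring]; exact hKκ s) X B

/-! ## §15.2 (DOM) WITHOUT DISPLACED-KERNEL DATA: the reference run's kernels and the displacements only [folklore]

The displaced run's kernels are `L_B + E_L`, `A_B + E_A`, `P_B + E_P`.  Its invertibilities and one-run decays (§10's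
`hdA`, `hA`, `hLA`, `hRA`, `hCA`) are PRODUCED by the reach lemmas `T4ActivityReach.resolvent_near` / `inv_near` from the
reference run's data WITH ROOM (decay of `L_B`, of the resolvents of `A_B` and of the displacements `E_L`, `E_A` at the
doubled rate `2δ`; of `P_B⁻¹` and `E_P` at rate `δ`) under the two REACH conditions `c r K² < 1`, `c_P r_P K² < 1`; both
runs are then entered into §15.1 at the COMMON constants `m̄ ≥ m + r_L`, `c′ ≥ c/(1 − c r K²)`, `c_P′ ≥ c_P/(1 − c_P r_P K²)`.
All lattice sums are dominated by the `δ/8`-rate ones. -/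

/-- [folklore] (bookkeeping) Lattice sums at a larger rate are under the sums at a smaller rate. -/
theorem latticeSum_mono {β : Type*} [Fintype β] (d : S → S → ℝ) (hd0 : ∀ s t, 0 ≤ d s t) (o : β → S)
    {σ σ' K : ℝ} (hσ : σ' ≤ σ) (hK : ∀ s, ∑ b, Real.exp (-(σ' * d s (o b))) ≤ K) (s : S) :
    ∑ b, Real.exp (-(σ * d s (o b))) ≤ K :=
  (Finset.sum_le_sum fun b _ => Real.exp_le_exp.mpr (by nlinarith [hd0 s (o b)])).trans (hK s)

/-- [folklore] (DOM) OF THE REACH: for the displaced kernels `L_B + E_L`, `A_B + E_A`, `P_B + E_P` against the reference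
kernels `L_B`, `A_B`, `P_B`, the pointwise domination `‖diffForm R₁ R₂ R₃ X B‖ ≤ ρ·domForm X B` with §10's constant at
the common constants `(m̄, c′, c_P′)` — from REFERENCE one-run data with room, the displacement sizes `r_L`, `r`,
`r_P`, and the reach conditions; NO hypothesis on the displaced run.  (`ρ` is LINEAR in `(r_L, r, r_P)` once `m̄`,
`c′`, `c_P′` are fixed over the reach: `norm_diffForm_le_of_reach_linear`.) -/
theorem norm_diffForm_le_of_reach [DecidableEq ι] [DecidableEq κ]
    (d : S → S → ℝ) (hd0 : ∀ s t, 0 ≤ d s t) (hsymm : ∀ s t, d s t = d t s)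
    (htri : ∀ s t w, d s w ≤ d s t + d t w) (p : ι → S) (q : κ → S)
    (LB EL : κ → ι → ℂ) (AB EA : Matrix ι ι ℂ)
    (hdB : ∀ u : ℝ, IsUnit (((u ^ 2 : ℝ) : ℂ) • (1 : Matrix ι ι ℂ) + AB).det)
    (PB EP : Matrix κ κ ℂ) (hB : IsUnit PB.det)
    (R₁ : ι → ι → ℂ) (R₂ : κ → κ → ℂ) (R₃ : κ → ι → ℂ)
    {m mb rL a c c' r cP cP' rP δ K : ℝ}
    (hm : 0 ≤ m) (hrL : 0 ≤ rL) (hmb : m + rL ≤ mb) (ha : 0 < a) (hc : 0 ≤ c) (hr : 0 ≤ r) (hcP : 0 ≤ cP)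
    (hrP : 0 ≤ rP) (hδ : 0 ≤ δ) (hK0 : 0 ≤ K)
    (hLB : ∀ a' i, ‖LB a' i‖ ≤ m * Real.exp (-(2 * δ * d (q a') (p i))))
    (hEL : ∀ a' i, ‖EL a' i‖ ≤ rL * Real.exp (-(2 * δ * d (q a') (p i))))
    (hRB : ∀ v i j, ‖T4ActivityTilt.resolvent AB v i j‖
      ≤ c * lorentz a v * Real.exp (-(2 * δ * d (p i) (p j))))
    (hEA : ∀ i j, ‖EA i j‖ ≤ r * Real.exp (-(2 * δ * d (p i) (p j))))
    (hCB : ∀ a' a'', ‖(PB⁻¹) a' a''‖ ≤ cP * Real.exp (-(δ * d (q a') (q a''))))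
    (hEP : ∀ a' a'', ‖EP a' a''‖ ≤ rP * Real.exp (-(δ * d (q a') (q a''))))
    (hsA : c * r * K ^ 2 < 1) (hsP : cP * rP * K ^ 2 < 1)
    (hc' : c / (1 - c * r * K ^ 2) ≤ c') (hcP' : cP / (1 - cP * rP * K ^ 2) ≤ cP')
    (hR₁ : ∀ b b', R₁ b b' = sandwichKer (mulKer (LB + EL) (sqrtKer (AB + EA))) ((PB + EP)⁻¹ : Matrix κ κ ℂ) b b'
      - sandwichKer (mulKer LB (sqrtKer AB)) (PB⁻¹ : Matrix κ κ ℂ) b b')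
    (hR₂ : ∀ a' a'', R₂ a' a'' = EP a' a'')
    (hR₃ : ∀ a' b, R₃ a' b = mulKer (LB + EL) (sqrtKer (AB + EA)) a' b - mulKer LB (sqrtKer AB) a' b)
    (hKι : ∀ s, ∑ b, Real.exp (-(δ / 8 * d s (p b))) ≤ K)
    (hKκ : ∀ s, ∑ a', Real.exp (-(δ / 8 * d s (q a'))) ≤ K) (X : ι → ℝ) (B : κ → ℝ) :
    ‖diffForm R₁ R₂ R₃ X B‖
      ≤ ((2 * (mb * (c' * Real.sqrt a) * K) * cP'
              * ((rL * (c' * Real.sqrt a) + mb * (c' ^ 2 * Real.sqrt a * r * K ^ 2)) * K)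
            + (mb * (c' * Real.sqrt a) * K) ^ 2 * (cP' * rP * cP' * K ^ 2)) * K ^ 2 * K + rP * K
            + (rL * (c' * Real.sqrt a) + mb * (c' ^ 2 * Real.sqrt a * r * K ^ 2)) * K * K)
          * domForm X B := by
  -- lattice sums at the rates used, all from the δ/8 ones
  have hK1p : ∀ s, ∑ b, Real.exp (-(2 * δ / 2 * d s (p b))) ≤ K :=
    latticeSum_mono d hd0 p (by linarith) hKι
  have hK2p : ∀ s, ∑ b, Real.exp (-(δ / 2 * d s (p b))) ≤ K :=
    latticeSum_mono d hd0 p (by linarith) hKι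
  have hK2q : ∀ s, ∑ a', Real.exp (-(δ / 2 * d s (q a'))) ≤ K :=
    latticeSum_mono d hd0 q (by linarith) hKκ
  -- constants
  have hden : 0 < 1 - c * r * K ^ 2 := by linarith
  have hdenP : 0 < 1 - cP * rP * K ^ 2 := by linarith
  have hcc' : c ≤ c' := (self_le_div_one_sub hc (by positivity) hsA).trans hc'
  have hcPcP' : cP ≤ cP' := (self_le_div_one_sub hcP (by positivity) hsP).trans hcP'
  have hc'0 : 0 ≤ c' := hc.trans hcc'
  have hcP'0 : 0 ≤ cP' := hcP.trans hcPcP'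
  have hδ2 : 0 ≤ 2 * δ := by positivity
  -- the displaced resolvent family (reach lemma)
  obtain ⟨hdA, hRA⟩ := resolvent_near d hd0 htri p AB EA hdB hc ha hr hδ2 hRB hEA hK1p hsA
  -- the displaced inverse covariance (reach lemma)
  obtain ⟨hA, hCA⟩ := inv_near d hd0 htri q PB EP hB hcP hrP hδ hCB hEP hK2q hsP
  -- both runs at the common constants and the junction's rates
  have e22 : ∀ t : ℝ, 2 * δ / 2 * t = δ * t := fun t => by ring
  have hmb0 : 0 ≤ mb := le_trans (by positivity) hmb
  have hLA' : ∀ a' i, ‖(LB + EL) a' i‖ ≤ mb * Real.exp (-(δ * d (q a') (p i))) := fun a' i => by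
    have h : ‖(LB + EL) a' i‖ ≤ (m + rL) * Real.exp (-(2 * δ * d (q a') (p i))) := by
      refine norm_le_of_near (hLB a' i) ?_
      rw [Pi.add_apply, Pi.add_apply, add_sub_cancel_left]; exact hEL a' i
    exact (entryBound_mono (by positivity) (by linarith) (hd0 _ _) h).trans
      (mul_le_mul_of_nonneg_right hmb (Real.exp_pos _).le)
  have hLB' : ∀ a' i, ‖LB a' i‖ ≤ mb * Real.exp (-(δ * d (q a') (p i))) := fun a' i =>
    (entryBound_mono hm (by linarith : δ ≤ 2 * δ) (hd0 _ _) (hLB a' i)).trans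
      (mul_le_mul_of_nonneg_right (by linarith) (Real.exp_pos _).le)
  have hL' : ∀ a' i, ‖(LB + EL) a' i - LB a' i‖ ≤ rL * Real.exp (-(δ * d (q a') (p i))) := fun a' i => by
    rw [Pi.add_apply, Pi.add_apply, add_sub_cancel_left]
    exact entryBound_mono hrL (by linarith) (hd0 _ _) (hEL a' i)
  have hRA' : ∀ v i j, ‖T4ActivityTilt.resolvent (AB + EA) v i j‖
      ≤ c' * lorentz a v * Real.exp (-(δ * d (p i) (p j))) := fun v i j => by
    have h := hRA v i j
    rw [e22] at h
    refine h.trans (mul_le_mul_of_nonneg_right (mul_le_mul_of_nonneg_right hc' (lorentz_nonneg ha v)) ?_)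
    exact (Real.exp_pos _).le
  have hRB' : ∀ v i j, ‖T4ActivityTilt.resolvent AB v i j‖
      ≤ c' * lorentz a v * Real.exp (-(δ * d (p i) (p j))) := fun v i j => by
    have h1 : c * lorentz a v * Real.exp (-(2 * δ * d (p i) (p j)))
        ≤ c' * lorentz a v * Real.exp (-(δ * d (p i) (p j))) :=
      mul_le_mul (mul_le_mul_of_nonneg_right hcc' (lorentz_nonneg ha v))
        (Real.exp_le_exp.mpr (by nlinarith [hd0 (p i) (p j)])) (Real.exp_pos _).le
        (mul_nonneg hc'0 (lorentz_nonneg ha v))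
    exact (hRB v i j).trans h1
  have hAB' : ∀ i j, ‖(AB + EA) i j - AB i j‖ ≤ r * Real.exp (-(δ * d (p i) (p j))) := fun i j => by
    rw [Matrix.add_apply, add_sub_cancel_left]
    exact entryBound_mono hr (by linarith) (hd0 _ _) (hEA i j)
  have hCA' : ∀ a' a'', ‖((PB + EP)⁻¹) a' a''‖ ≤ cP' * Real.exp (-(δ / 2 * d (q a') (q a''))) :=
    fun a' a'' => (hCA a' a'').trans (mul_le_mul_of_nonneg_right hcP' (Real.exp_pos _).le)
  have hCB' : ∀ a' a'', ‖(PB⁻¹) a' a''‖ ≤ cP' * Real.exp (-(δ / 2 * d (q a') (q a''))) := fun a' a'' =>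
    (entryBound_mono hcP (by linarith : δ / 2 ≤ δ) (hd0 _ _) (hCB a' a'')).trans
      (mul_le_mul_of_nonneg_right hcPcP' (Real.exp_pos _).le)
  have hP' : ∀ a' a'', ‖(PB + EP) a' a'' - PB a' a''‖ ≤ rP * Real.exp (-(δ / 2 * d (q a') (q a''))) :=
    fun a' a'' => by
    rw [Matrix.add_apply, add_sub_cancel_left]
    exact entryBound_mono hrP (by linarith) (hd0 _ _) (hEP a' a'')
  have hR₂' : ∀ a' a'', R₂ a' a'' = (PB + EP) a' a'' - PB a' a'' := fun a' a'' => by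
    rw [hR₂, Matrix.add_apply]; ring
  exact norm_diffForm_le_of_resolventBounds d hd0 hsymm htri p q (LB + EL) LB (AB + EA) AB hdA hdB
    (PB + EP) PB hA hB R₁ R₂ R₃ hmb0 hrL ha hc'0 hr hcP'0 hrP hδ hK0
    hLA' hLB' hL' hRA' hRB' hAB' hCA' hCB' hP' hR₁ hR₂' hR₃ hK2p hKι hKκ X B

/-- [folklore] (DOM) OF THE REACH, LINEAR IN THE OPERATOR DISPLACEMENT: with displacement sizes `r_L = κ_L δ`,
`r = κ_A δ`, `r_P = κ_P δ` LINEAR in one relative size `δ ∈ [0, 1]` (the operator slot's `‖q.1 − p.1‖/ϱOp`), reach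
conditions and common constants fixed over the whole reach (`c κ_A K² < 1`, `c_P κ_P K² < 1`, `c′ ≥ c/(1 − c κ_A K²)`,
`c_P′ ≥ c_P/(1 − c_P κ_P K²)`, `m̄ = m + κ_L`), the domination constant is `c_ρ · δ` with `c_ρ` FREE OF `δ` — the
`ρ ≤ c_ρ δ_op` hypothesis of `T4ActivityTiltHistory.twoSpecies_of_tilt_affine` for the Gaussian channel, PRODUCED. -/
theorem norm_diffForm_le_of_reach_linear [DecidableEq ι] [DecidableEq κ]
    (d : S → S → ℝ) (hd0 : ∀ s t, 0 ≤ d s t) (hsymm : ∀ s t, d s t = d t s)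
    (htri : ∀ s t w, d s w ≤ d s t + d t w) (p : ι → S) (q : κ → S)
    (LB EL : κ → ι → ℂ) (AB EA : Matrix ι ι ℂ)
    (hdB : ∀ u : ℝ, IsUnit (((u ^ 2 : ℝ) : ℂ) • (1 : Matrix ι ι ℂ) + AB).det)
    (PB EP : Matrix κ κ ℂ) (hB : IsUnit PB.det)
    (R₁ : ι → ι → ℂ) (R₂ : κ → κ → ℂ) (R₃ : κ → ι → ℂ)
    {m κL a c c' κA cP cP' κP δ K t : ℝ}
    (hm : 0 ≤ m) (hκL : 0 ≤ κL) (ha : 0 < a) (hc : 0 ≤ c) (hκA : 0 ≤ κA) (hcP : 0 ≤ cP)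
    (hκP : 0 ≤ κP) (hδ : 0 ≤ δ) (hK0 : 0 ≤ K) (ht0 : 0 ≤ t) (ht1 : t ≤ 1)
    (hLB : ∀ a' i, ‖LB a' i‖ ≤ m * Real.exp (-(2 * δ * d (q a') (p i))))
    (hEL : ∀ a' i, ‖EL a' i‖ ≤ κL * t * Real.exp (-(2 * δ * d (q a') (p i))))
    (hRB : ∀ v i j, ‖T4ActivityTilt.resolvent AB v i j‖
      ≤ c * lorentz a v * Real.exp (-(2 * δ * d (p i) (p j))))
    (hEA : ∀ i j, ‖EA i j‖ ≤ κA * t * Real.exp (-(2 * δ * d (p i) (p j))))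
    (hCB : ∀ a' a'', ‖(PB⁻¹) a' a''‖ ≤ cP * Real.exp (-(δ * d (q a') (q a''))))
    (hEP : ∀ a' a'', ‖EP a' a''‖ ≤ κP * t * Real.exp (-(δ * d (q a') (q a''))))
    (hsA : c * κA * K ^ 2 < 1) (hsP : cP * κP * K ^ 2 < 1)
    (hc' : c / (1 - c * κA * K ^ 2) ≤ c') (hcP' : cP / (1 - cP * κP * K ^ 2) ≤ cP')
    (hR₁ : ∀ b b', R₁ b b' = sandwichKer (mulKer (LB + EL) (sqrtKer (AB + EA))) ((PB + EP)⁻¹ : Matrix κ κ ℂ) b b'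
      - sandwichKer (mulKer LB (sqrtKer AB)) (PB⁻¹ : Matrix κ κ ℂ) b b')
    (hR₂ : ∀ a' a'', R₂ a' a'' = EP a' a'')
    (hR₃ : ∀ a' b, R₃ a' b = mulKer (LB + EL) (sqrtKer (AB + EA)) a' b - mulKer LB (sqrtKer AB) a' b)
    (hKι : ∀ s, ∑ b, Real.exp (-(δ / 8 * d s (p b))) ≤ K)
    (hKκ : ∀ s, ∑ a', Real.exp (-(δ / 8 * d s (q a'))) ≤ K) (X : ι → ℝ) (B : κ → ℝ) :
    ‖diffForm R₁ R₂ R₃ X B‖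
      ≤ (((2 * ((m + κL) * (c' * Real.sqrt a) * K) * cP'
              * ((κL * (c' * Real.sqrt a) + (m + κL) * (c' ^ 2 * Real.sqrt a * κA * K ^ 2)) * K)
            + ((m + κL) * (c' * Real.sqrt a) * K) ^ 2 * (cP' * κP * cP' * K ^ 2)) * K ^ 2 * K + κP * K
            + (κL * (c' * Real.sqrt a) + (m + κL) * (c' ^ 2 * Real.sqrt a * κA * K ^ 2)) * K * K) * t)
          * domForm X B := by
  have hK2 : 0 ≤ K ^ 2 := sq_nonneg K
  have hrA : c * (κA * t) * K ^ 2 ≤ c * κA * K ^ 2 := by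
    have : c * (κA * t) * K ^ 2 = (c * κA * K ^ 2) * t := by ring
    rw [this]; exact mul_le_of_le_one_right (by positivity) ht1
  have hrP : cP * (κP * t) * K ^ 2 ≤ cP * κP * K ^ 2 := by
    have : cP * (κP * t) * K ^ 2 = (cP * κP * K ^ 2) * t := by ring
    rw [this]; exact mul_le_of_le_one_right (by positivity) ht1
  have hsA' : c * (κA * t) * K ^ 2 < 1 := lt_of_le_of_lt hrA hsA
  have hsP' : cP * (κP * t) * K ^ 2 < 1 := lt_of_le_of_lt hrP hsP
  have hc'' : c / (1 - c * (κA * t) * K ^ 2) ≤ c' :=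
    (div_le_div_of_nonneg_left hc (by linarith) (by linarith)).trans hc'
  have hcP'' : cP / (1 - cP * (κP * t) * K ^ 2) ≤ cP' :=
    (div_le_div_of_nonneg_left hcP (by linarith) (by linarith)).trans hcP'
  have hmb : m + κL * t ≤ m + κL := by nlinarith
  have h := norm_diffForm_le_of_reach d hd0 hsymm htri p q LB EL AB EA hdB PB EP hB R₁ R₂ R₃
    (rL := κL * t) (r := κA * t) (rP := κP * t)
    hm (by positivity) hmb ha hc (by positivity) hcP (by positivity) hδ hK0 hLB hEL hRB hEA hCB hEP
    hsA' hsP' hc'' hcP'' hR₁ hR₂ hR₃ hKι hKκ X B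
  calc ‖diffForm R₁ R₂ R₃ X B‖ ≤ _ := h
    _ = _ := by ring

/-! ## §15.3 The operator channel assembled: Gaussian (DOM) of the reach + potential channel, moduli linear [folklore]

With the potential channel's term rates ALSO linear in the operator displacement (`‖τ(Y)(Q_A − Q_B)(Y)_{bb′}‖ ≤ κ_Q δ·w k`,
`‖τ(Y)(𝐕″_A − 𝐕″_B)(Y)‖ ≤ κ_R δ·v` — rate data of `InsertionRate`/`OperatorRate` KIND, NOT PRINTED as two-run facts),
`T4ActivityTiltPotential.potDom_of_termRates` and `dom_affine_of_channels` give the operator channel's affine domination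
with BOTH moduli linear in `δ`: `‖Δ_G + Δ_V‖ ≤ (c_G + κ_Q W K)δ·domForm + (κ_R n₀K″)δ` — the hypotheses `hρ : ρ ≤ c_ρ δ_op`,
`hβop : βop ≤ c_β δ_op` of the two-species moduli theorem, PRODUCED. -/

/-- [folklore] (bookkeeping) THE OPERATOR CHANNEL OF THE REACH: Gaussian domination linear in `δ` (§15.2) + potential
term rates linear in `δ` ⟹ `‖Δ_G + potSum‖ ≤ ((c_G + κ_Q W K)δ)·domForm X B + (κ_R(n₀K″))δ`. -/
theorem opDom_of_reach_linear [DecidableEq κ] [DecidableEq 𝒞] (D : Finset 𝒴) (bonds : 𝒴 → Finset κ)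
    (cubes : 𝒴 → Finset 𝒞) (cubes₀ : Finset 𝒞) (τ : 𝒴 → ℂ) (Q : 𝒴 → κ → κ → ℂ) (Rm : 𝒴 → ℂ)
    (w : 𝒴 → ℝ) (k : κ → κ → ℝ) (v : 𝒴 → ℝ) {ΔG : ℂ} {cG κQ κR W K K'' t : ℝ} (X : ι → ℝ) (B : κ → ℝ)
    (hκQ : 0 ≤ κQ) (hκR : 0 ≤ κR) (ht0 : 0 ≤ t) (hW0 : 0 ≤ W) (hK : 0 ≤ K)
    (hG : ‖ΔG‖ ≤ cG * t * domForm X B)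
    (hQ : ∀ Y ∈ D, ∀ b ∈ bonds Y, ∀ b' ∈ bonds Y, ‖τ Y * Q Y b b'‖ ≤ κQ * t * (w Y * k b b'))
    (hw : ∀ Y ∈ D, 0 ≤ w Y) (hk : ∀ b b', 0 ≤ k b b')
    (hW : ∀ b, ∑ Y ∈ D.filter (fun Y => b ∈ bonds Y), w Y ≤ W)
    (hrow : ∀ b, ∑ b', k b b' ≤ K) (hcol : ∀ b', ∑ b, k b b' ≤ K)
    (hR : ∀ Y ∈ D, ‖τ Y * Rm Y‖ ≤ κR * t * v Y) (hv : ∀ Y ∈ D, 0 ≤ v Y)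
    (hmeet : ∀ Y ∈ D, ∃ c ∈ cubes₀, c ∈ cubes Y)
    (hpin : ∀ c ∈ cubes₀, ∑ Y ∈ D.filter (fun Y => c ∈ cubes Y), v Y ≤ K'') :
    ‖ΔG + potSum D bonds τ Q Rm B‖
      ≤ ((cG + κQ * W * K) * t) * domForm X B + (κR * (cubes₀.card * K'')) * t := by
  have hV := potDom_of_termRates D bonds cubes cubes₀ τ Q Rm w k v (rQ := κQ * t) (r'' := κR * t)
    (by positivity) (by positivity) hQ hw hk hW hrow hcol hK hR hv hmeet hpin B
  have h := dom_affine_of_channels (ρG := cG * t) (by positivity : 0 ≤ κQ * t * W * K) hG hV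
    (half_sum_sq_le_domForm X B)
  calc _ ≤ _ := h
    _ = _ := by ring

/-! ## §15.4 The normalised two-run bound of a (2.14)-term WITHOUT ANY displaced-endpoint datum [folklore]

In the currency of `T4ActivityTiltHistory.norm_tiltedTerm_sub_le_twoSpecies` (operator channel `Δop` under an affine
domination `ρP + βop` — the Gaussian part PRODUCED by §15.2, the potential part by `T4ActivityTiltPotential.potDom_of_
termRates` —, history channel `Δh` bounded by `βh`): the displaced tilted majorant, the integrability of the displaced
integrand, the displaced normalisation `z_A ≠ 0` and the determinant-channel constant `ζ` are DISCHARGED by the reach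
lemmas of `T4ActivityReach` §14.3–§14.4 from the REFERENCE endpoint's majorants WITH ROOM (`u′ ≥ u + ρ`,
`u₀′ ≥ u₀ + ρ₀`) and the reach condition `2E₀ ≤ ‖z_B‖`.  What remains displaced-side is NOTHING; what remains two-run
are the numbers `ρ, βop, βh, ρ₀` (rates) — the NOT-PRINTED content, now confined to `OperatorRate`/`InsertionRate`-type
data of `T4ActivityRecursion`. -/

/-- [folklore] THE TWO-SPECIES BOUND OF THE REACH.  Reference integrand `F` (integrable), dominating form `P ≥ 0`,
channels `Δop`, `Δh` with `‖Δop‖ ≤ ρP + βop`, `‖Δh‖ ≤ βh` (a.e.-strongly measurable, as is `P`), reference majorant with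
room `∫ e^{u′P}‖F‖ ≤ M′`, `u + ρ ≤ u′`; normalisation space with reference density `φ` (integrable), tilt `Δ₀` under
`‖Δ₀‖ ≤ ρ₀P₀`, reference normalisation majorant with room `∫ e^{u₀′P₀}‖φ‖ ≤ M₀′`, `u₀ + ρ₀ ≤ u₀′`, `z_B = ∫φ ≠ 0`, and
the reach `2E₀ ≤ ‖z_B‖`, `E₀ = (ρ₀/(e u₀))·2M₀′`.  THEN, with `z_A = ∫ e^{−Δ₀}•φ` the displaced normalisation:
`z_A ≠ 0`, `‖z_B‖/2 ≤ ‖z_A‖`, `‖z_B/z_A − 1‖ ≤ 2E₀/‖z_B‖`, and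
`‖z_A⁻¹•∫e^{−(Δop+Δh)}•F − z_B⁻¹•∫F‖ ≤ ((ρ + e u(βop + βh))/(e u)·(e^{βop+βh}M′ + M′))/‖z_A‖ + (2E₀/‖z_B‖)(M′/‖z_B‖)` —
`T4ActivityTiltHistory.norm_tiltedTerm_sub_le_twoSpecies` with its displaced (ROB) majorant (`M_A = e^{βop+βh}M′`,
`majorant_transfer`), displaced integrability (`integrable_tilted`), displaced normalisation and determinant constant
(`det_of_reach`) ALL DISCHARGED; no hypothesis mentions the displaced endpoint. -/
theorem twoSpecies_of_reach [MeasurableSpace Ω] [MeasurableSpace Ω₀] (ν : Measure Ω) (F : Ω → E)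
    (Δop Δh : Ω → ℂ) (P : Ω → ℝ) (ν₀ : Measure Ω₀) (φ : Ω₀ → ℂ) (Δ₀ : Ω₀ → ℂ) (P₀ : Ω₀ → ℝ)
    {ρ βop βh u u' M' ρ₀ u₀ u₀' M₀' : ℝ}
    (hρ : 0 ≤ ρ) (hβop : 0 ≤ βop) (hβh : 0 ≤ βh) (hu : 0 < u) (huu' : u + ρ ≤ u')
    (hdomop : ∀ x, ‖Δop x‖ ≤ ρ * P x + βop) (hdomh : ∀ x, ‖Δh x‖ ≤ βh) (hP : ∀ x, 0 ≤ P x)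
    (hF : Integrable F ν) (hΔopm : AEStronglyMeasurable Δop ν) (hΔhm : AEStronglyMeasurable Δh ν)
    (hPm : AEStronglyMeasurable P ν)
    (hI' : Integrable (fun x => Real.exp (u' * P x) * ‖F x‖) ν)
    (hM' : ∫ x, Real.exp (u' * P x) * ‖F x‖ ∂ν ≤ M')
    (hρ₀ : 0 ≤ ρ₀) (hu₀ : 0 < u₀) (hu₀u₀' : u₀ + ρ₀ ≤ u₀')
    (hdom₀ : ∀ y, ‖Δ₀ y‖ ≤ ρ₀ * P₀ y) (hP₀ : ∀ y, 0 ≤ P₀ y)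
    (hφ : Integrable φ ν₀) (hΔ₀m : AEStronglyMeasurable Δ₀ ν₀) (hP₀m : AEStronglyMeasurable P₀ ν₀)
    (hI0' : Integrable (fun y => Real.exp (u₀' * P₀ y) * ‖φ y‖) ν₀)
    (hM0' : ∫ y, Real.exp (u₀' * P₀ y) * ‖φ y‖ ∂ν₀ ≤ M₀')
    (hzB : (∫ y, φ y ∂ν₀) ≠ 0)
    (hreach : 2 * (ρ₀ / (Real.exp 1 * u₀) * (M₀' + M₀')) ≤ ‖∫ y, φ y ∂ν₀‖) :
    (∫ y, Complex.exp (-Δ₀ y) • φ y ∂ν₀) ≠ 0 ∧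
    ‖∫ y, φ y ∂ν₀‖ / 2 ≤ ‖∫ y, Complex.exp (-Δ₀ y) • φ y ∂ν₀‖ ∧
    ‖(∫ y, φ y ∂ν₀) / (∫ y, Complex.exp (-Δ₀ y) • φ y ∂ν₀) - 1‖
      ≤ 2 * (ρ₀ / (Real.exp 1 * u₀) * (M₀' + M₀')) / ‖∫ y, φ y ∂ν₀‖ ∧
    ‖(∫ y, Complex.exp (-Δ₀ y) • φ y ∂ν₀)⁻¹ • (∫ x, Complex.exp (-(Δop x + Δh x)) • F x ∂ν)
        - (∫ y, φ y ∂ν₀)⁻¹ • (∫ x, F x ∂ν)‖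
      ≤ ((ρ + Real.exp 1 * u * (βop + βh)) / (Real.exp 1 * u) * (Real.exp (βop + βh) * M' + M'))
            / ‖∫ y, Complex.exp (-Δ₀ y) • φ y ∂ν₀‖
          + 2 * (ρ₀ / (Real.exp 1 * u₀) * (M₀' + M₀')) / ‖∫ y, φ y ∂ν₀‖ * (M' / ‖∫ y, φ y ∂ν₀‖) := by
  -- the full tilt and its affine domination
  have hdom : ∀ x, ‖Δop x + Δh x‖ ≤ ρ * P x + (βop + βh) := fun x =>
    (norm_add_le _ _).trans (by linarith [hdomop x, hdomh x])
  have hΔm : AEStronglyMeasurable (fun x => Δop x + Δh x) ν := hΔopm.add hΔhm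
  -- reference (ROB) datum at growth u, displaced (ROB) datum by transfer, displaced integrability
  obtain ⟨hIB, hMB⟩ := majorant_mono ν F P hP (by linarith : u ≤ u') hPm hF.aestronglyMeasurable hI' hM'
  obtain ⟨hIA, hMA⟩ := majorant_transfer ν F (fun x => Δop x + Δh x) P hdom hP huu' hΔm hPm
    hF.aestronglyMeasurable hI' hM'
  have hFA : Integrable (fun x => Complex.exp (-(Δop x + Δh x)) • F x) ν :=
    integrable_tilted ν F (fun x => Δop x + Δh x) P hdom hP (by linarith : ρ ≤ u') hΔm
      hF.aestronglyMeasurable hI'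
  -- normalisation space: the same three productions, with β = 0
  have hdom₀' : ∀ y, ‖Δ₀ y‖ ≤ ρ₀ * P₀ y + 0 := fun y => by rw [add_zero]; exact hdom₀ y
  obtain ⟨hI0B, hM0B⟩ := majorant_mono ν₀ φ P₀ hP₀ (by linarith : u₀ ≤ u₀') hP₀m hφ.aestronglyMeasurable
    hI0' hM0'
  obtain ⟨hI0A, hM0A⟩ := majorant_transfer ν₀ φ Δ₀ P₀ hdom₀' hP₀ hu₀u₀' hΔ₀m hP₀m hφ.aestronglyMeasurable
    hI0' hM0'
  rw [Real.exp_zero, one_mul] at hM0A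
  have hφA : Integrable (fun y => Complex.exp (-Δ₀ y) • φ y) ν₀ :=
    integrable_tilted ν₀ φ Δ₀ P₀ hdom₀' hP₀ (by linarith : ρ₀ ≤ u₀') hΔ₀m hφ.aestronglyMeasurable hI0'
  -- the determinant bootstrap
  obtain ⟨hzA, hlow, hζ⟩ := det_of_reach ν₀ φ Δ₀ P₀ hρ₀ hu₀ hdom₀ hφ hφA hI0B hM0B hI0A hM0A hzB hreach
  -- the two-species bound with the displaced data discharged
  exact ⟨hzA, hlow, hζ, norm_tiltedTerm_sub_le_twoSpecies ν F Δop Δh P hρ hβop hβh hu hzA hzB hdomop hdomh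
    hP hF hFA hIB hMB hIA hMA hζ⟩

/-- [folklore] (bookkeeping) The same bound in units of the REFERENCE normalisation only (`‖z_A‖ ≥ ‖z_B‖/2`):
`≤ ((ρ + e u(βop + βh))/(e u)·(e^{βop+βh}M′ + M′))/(‖z_B‖/2) + (2E₀/‖z_B‖)(M′/‖z_B‖)`. -/
theorem twoSpecies_of_reach_ref [MeasurableSpace Ω] [MeasurableSpace Ω₀] (ν : Measure Ω) (F : Ω → E)
    (Δop Δh : Ω → ℂ) (P : Ω → ℝ) (ν₀ : Measure Ω₀) (φ : Ω₀ → ℂ) (Δ₀ : Ω₀ → ℂ) (P₀ : Ω₀ → ℝ)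
    {ρ βop βh u u' M' ρ₀ u₀ u₀' M₀' : ℝ}
    (hρ : 0 ≤ ρ) (hβop : 0 ≤ βop) (hβh : 0 ≤ βh) (hu : 0 < u) (huu' : u + ρ ≤ u')
    (hdomop : ∀ x, ‖Δop x‖ ≤ ρ * P x + βop) (hdomh : ∀ x, ‖Δh x‖ ≤ βh) (hP : ∀ x, 0 ≤ P x)
    (hF : Integrable F ν) (hΔopm : AEStronglyMeasurable Δop ν) (hΔhm : AEStronglyMeasurable Δh ν)
    (hPm : AEStronglyMeasurable P ν)
    (hI' : Integrable (fun x => Real.exp (u' * P x) * ‖F x‖) ν)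
    (hM' : ∫ x, Real.exp (u' * P x) * ‖F x‖ ∂ν ≤ M')
    (hρ₀ : 0 ≤ ρ₀) (hu₀ : 0 < u₀) (hu₀u₀' : u₀ + ρ₀ ≤ u₀')
    (hdom₀ : ∀ y, ‖Δ₀ y‖ ≤ ρ₀ * P₀ y) (hP₀ : ∀ y, 0 ≤ P₀ y)
    (hφ : Integrable φ ν₀) (hΔ₀m : AEStronglyMeasurable Δ₀ ν₀) (hP₀m : AEStronglyMeasurable P₀ ν₀)
    (hI0' : Integrable (fun y => Real.exp (u₀' * P₀ y) * ‖φ y‖) ν₀)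
    (hM0' : ∫ y, Real.exp (u₀' * P₀ y) * ‖φ y‖ ∂ν₀ ≤ M₀')
    (hzB : (∫ y, φ y ∂ν₀) ≠ 0)
    (hreach : 2 * (ρ₀ / (Real.exp 1 * u₀) * (M₀' + M₀')) ≤ ‖∫ y, φ y ∂ν₀‖) :
    ‖(∫ y, Complex.exp (-Δ₀ y) • φ y ∂ν₀)⁻¹ • (∫ x, Complex.exp (-(Δop x + Δh x)) • F x ∂ν)
        - (∫ y, φ y ∂ν₀)⁻¹ • (∫ x, F x ∂ν)‖
      ≤ ((ρ + Real.exp 1 * u * (βop + βh)) / (Real.exp 1 * u) * (Real.exp (βop + βh) * M' + M'))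
            / (‖∫ y, φ y ∂ν₀‖ / 2)
          + 2 * (ρ₀ / (Real.exp 1 * u₀) * (M₀' + M₀')) / ‖∫ y, φ y ∂ν₀‖ * (M' / ‖∫ y, φ y ∂ν₀‖) := by
  obtain ⟨_, hlow, _, hT⟩ := twoSpecies_of_reach ν F Δop Δh P ν₀ φ Δ₀ P₀ hρ hβop hβh hu huu' hdomop hdomh hP
    hF hΔopm hΔhm hPm hI' hM' hρ₀ hu₀ hu₀u₀' hdom₀ hP₀ hφ hΔ₀m hP₀m hI0' hM0' hzB hreach
  refine hT.trans (add_le_add ?_ le_rfl)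
  have hnum : 0 ≤ (ρ + Real.exp 1 * u * (βop + βh)) / (Real.exp 1 * u)
      * (Real.exp (βop + βh) * M' + M') := by
    have hM'0 : 0 ≤ M' := le_trans (integral_nonneg fun x => by positivity) hM'
    positivity
  have hzB0 : 0 < ‖∫ y, φ y ∂ν₀‖ / 2 := by
    have := norm_pos_iff.mpr hzB; linarith
  exact div_le_div_of_nonneg_left hnum hzB0 hlow

/-- [folklore] **THE (9.3)-SHAPE OF THE REACH** — `twoSpecies_of_tilt_affine`'s hypotheses ALL DISCHARGED but the rate
moduli: if in `twoSpecies_of_reach` the rates are linear in the two relative sizes, `ρ ≤ c_ρ δ_op`, `βop ≤ c_β δ_op`,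
`ρ₀ ≤ c₀ δ_op` (`δ_op ∈ [0, 1]`), `βh ≤ c_h δ_h`, and `βop + βh ≤ β̄` over the reach, then `z_A ≠ 0` and
`‖z_A⁻¹•∫e^{−(Δop+Δh)}•F − z_B⁻¹•∫F‖ ≤ Λop·G·δ_op + Λh·G·δ_h` with the ENVELOPE `G = 2e^{β̄}M′/‖z_B‖` (reference data),
`Λop = (c_ρ + e u c_β)(2 + c_ζ)/(e u) + c_ζ`, `Λh = c_h(2 + c_ζ)`, `c_ζ = 4c₀M₀′/(e u₀‖z_B‖)` — the per-term `hslot` shape of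
`T4ActivityThreshold.activityLipschitz₂_of_termSlots` (`δ_op = ‖q.1 − p.1‖/ϱOp`, `δ_h = ‖q.2 − p.2‖/ϱHist`), every
modulus a function of REFERENCE one-run data and of the rate constants `c_ρ, c_β, c₀, c_h` ALONE. -/
theorem twoSpecies_of_reach_affine [MeasurableSpace Ω] [MeasurableSpace Ω₀] (ν : Measure Ω) (F : Ω → E)
    (Δop Δh : Ω → ℂ) (P : Ω → ℝ) (ν₀ : Measure Ω₀) (φ : Ω₀ → ℂ) (Δ₀ : Ω₀ → ℂ) (P₀ : Ω₀ → ℝ)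
    {ρ βop βh u u' M' ρ₀ u₀ u₀' M₀' δop δh cρ cβ c₀ ch βbar : ℝ}
    (hρ : 0 ≤ ρ) (hβop : 0 ≤ βop) (hβh : 0 ≤ βh) (hu : 0 < u) (huu' : u + ρ ≤ u')
    (hdomop : ∀ x, ‖Δop x‖ ≤ ρ * P x + βop) (hdomh : ∀ x, ‖Δh x‖ ≤ βh) (hP : ∀ x, 0 ≤ P x)
    (hF : Integrable F ν) (hΔopm : AEStronglyMeasurable Δop ν) (hΔhm : AEStronglyMeasurable Δh ν)
    (hPm : AEStronglyMeasurable P ν)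
    (hI' : Integrable (fun x => Real.exp (u' * P x) * ‖F x‖) ν)
    (hM' : ∫ x, Real.exp (u' * P x) * ‖F x‖ ∂ν ≤ M')
    (hρ₀ : 0 ≤ ρ₀) (hu₀ : 0 < u₀) (hu₀u₀' : u₀ + ρ₀ ≤ u₀')
    (hdom₀ : ∀ y, ‖Δ₀ y‖ ≤ ρ₀ * P₀ y) (hP₀ : ∀ y, 0 ≤ P₀ y)
    (hφ : Integrable φ ν₀) (hΔ₀m : AEStronglyMeasurable Δ₀ ν₀) (hP₀m : AEStronglyMeasurable P₀ ν₀)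
    (hI0' : Integrable (fun y => Real.exp (u₀' * P₀ y) * ‖φ y‖) ν₀)
    (hM0' : ∫ y, Real.exp (u₀' * P₀ y) * ‖φ y‖ ∂ν₀ ≤ M₀')
    (hzB : (∫ y, φ y ∂ν₀) ≠ 0)
    (hreach : 2 * (ρ₀ / (Real.exp 1 * u₀) * (M₀' + M₀')) ≤ ‖∫ y, φ y ∂ν₀‖)
    (hδ0 : 0 ≤ δop) (hδ1 : δop ≤ 1) (hc₀ : 0 ≤ c₀)
    (hρc : ρ ≤ cρ * δop) (hβopc : βop ≤ cβ * δop) (hρ₀c : ρ₀ ≤ c₀ * δop) (hβhc : βh ≤ ch * δh)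
    (hβbar : βop + βh ≤ βbar) :
    (∫ y, Complex.exp (-Δ₀ y) • φ y ∂ν₀) ≠ 0 ∧
    ‖(∫ y, Complex.exp (-Δ₀ y) • φ y ∂ν₀)⁻¹ • (∫ x, Complex.exp (-(Δop x + Δh x)) • F x ∂ν)
        - (∫ y, φ y ∂ν₀)⁻¹ • (∫ x, F x ∂ν)‖
      ≤ ((cρ + Real.exp 1 * u * cβ) * (2 + 4 * c₀ * M₀' / (Real.exp 1 * u₀ * ‖∫ y, φ y ∂ν₀‖))
              / (Real.exp 1 * u) + 4 * c₀ * M₀' / (Real.exp 1 * u₀ * ‖∫ y, φ y ∂ν₀‖))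
            * (2 * Real.exp βbar * M' / ‖∫ y, φ y ∂ν₀‖) * δop
          + ch * (2 + 4 * c₀ * M₀' / (Real.exp 1 * u₀ * ‖∫ y, φ y ∂ν₀‖))
            * (2 * Real.exp βbar * M' / ‖∫ y, φ y ∂ν₀‖) * δh := by
  obtain ⟨hzA, hlow, hζ, hT⟩ := twoSpecies_of_reach ν F Δop Δh P ν₀ φ Δ₀ P₀ hρ hβop hβh hu huu' hdomop hdomh
    hP hF hΔopm hΔhm hPm hI' hM' hρ₀ hu₀ hu₀u₀' hdom₀ hP₀ hφ hΔ₀m hP₀m hI0' hM0' hzB hreach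
  have hM'0 : 0 ≤ M' := le_trans (integral_nonneg fun x => by positivity) hM'
  have hM0'0 : 0 ≤ M₀' := le_trans (integral_nonneg fun y => by positivity) hM0'
  have hnB : 0 < ‖∫ y, φ y ∂ν₀‖ := norm_pos_iff.mpr hzB
  have hnA : 0 < ‖∫ y, Complex.exp (-Δ₀ y) • φ y ∂ν₀‖ := norm_pos_iff.mpr hzA
  have he : Real.exp 1 * u₀ ≠ 0 := (mul_pos (Real.exp_pos 1) hu₀).ne'
  have heu₀ : 0 < Real.exp 1 * u₀ := mul_pos (Real.exp_pos 1) hu₀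
  -- the determinant constant is linear in δ_op
  have key : 2 * (ρ₀ / (Real.exp 1 * u₀) * (M₀' + M₀')) / ‖∫ y, φ y ∂ν₀‖
      = ρ₀ * (4 * M₀' / (Real.exp 1 * u₀ * ‖∫ y, φ y ∂ν₀‖)) := by
    field_simp
    ring
  have hq0 : 0 ≤ 4 * M₀' / (Real.exp 1 * u₀ * ‖∫ y, φ y ∂ν₀‖) := by positivity
  have hζ0 : 0 ≤ 2 * (ρ₀ / (Real.exp 1 * u₀) * (M₀' + M₀')) / ‖∫ y, φ y ∂ν₀‖ := by positivity
  have hζc : 2 * (ρ₀ / (Real.exp 1 * u₀) * (M₀' + M₀')) / ‖∫ y, φ y ∂ν₀‖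
      ≤ 4 * c₀ * M₀' / (Real.exp 1 * u₀ * ‖∫ y, φ y ∂ν₀‖) * δop := by
    rw [key]
    have : 4 * c₀ * M₀' / (Real.exp 1 * u₀ * ‖∫ y, φ y ∂ν₀‖) * δop
        = (c₀ * δop) * (4 * M₀' / (Real.exp 1 * u₀ * ‖∫ y, φ y ∂ν₀‖)) := by ring
    rw [this]
    exact mul_le_mul_of_nonneg_right hρ₀c hq0
  have hcζ : 0 ≤ 4 * c₀ * M₀' / (Real.exp 1 * u₀ * ‖∫ y, φ y ∂ν₀‖) := by positivity
  -- the envelope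
  have hβbar0 : 0 ≤ βbar := le_trans (add_nonneg hβop hβh) hβbar
  have hG : 0 ≤ 2 * Real.exp βbar * M' / ‖∫ y, φ y ∂ν₀‖ := by positivity
  have hGA : Real.exp (βop + βh) * M' / ‖∫ y, Complex.exp (-Δ₀ y) • φ y ∂ν₀‖
      ≤ 2 * Real.exp βbar * M' / ‖∫ y, φ y ∂ν₀‖ := by
    have h1 : Real.exp (βop + βh) * M' / ‖∫ y, Complex.exp (-Δ₀ y) • φ y ∂ν₀‖
        ≤ Real.exp βbar * M' / (‖∫ y, φ y ∂ν₀‖ / 2) :=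
      div_le_div₀ (by positivity) (mul_le_mul_of_nonneg_right (Real.exp_le_exp.mpr hβbar) hM'0)
        (by positivity) hlow
    calc _ ≤ _ := h1
      _ = 2 * Real.exp βbar * M' / ‖∫ y, φ y ∂ν₀‖ := by
          field_simp
  have hGB : M' / ‖∫ y, φ y ∂ν₀‖ ≤ 2 * Real.exp βbar * M' / ‖∫ y, φ y ∂ν₀‖ := by
    refine div_le_div_of_nonneg_right ?_ hnB.le
    have h1 : (1 : ℝ) ≤ Real.exp βbar := Real.one_le_exp hβbar0
    nlinarith
  have hAB : ‖∫ y, φ y ∂ν₀‖ / ‖∫ y, Complex.exp (-Δ₀ y) • φ y ∂ν₀‖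
      ≤ 1 + 2 * (ρ₀ / (Real.exp 1 * u₀) * (M₀' + M₀')) / ‖∫ y, φ y ∂ν₀‖ :=
    norm_div_norm_le_one_add hζ
  exact ⟨hzA, twoSpecies_of_tilt_affine hT hu hnA hnB hδ0 hδ1 hG hcζ hρ hρc hβop hβopc hζ0 hζc hβh hβhc
    (by positivity) hM'0 hGA hGB hAB⟩

/-! ## §15.5 The whole chain: the per-term two-species slot of a (2.14)-term from REFERENCE data and linear rates [folklore]

One theorem composing §15.2–§15.4 for the (2.14)-term SHAPE of `T4ActivityTilt`'s header: the operator channel is the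
Gaussian difference form of the displaced-vs-reference kernels in the term's real Gaussian variables `(X(x), B(x))` plus the
potential sum of the difference kernels, the history channel is any `Δh` with `‖Δh‖ ≤ βh ≤ c_h δ_h` (§12 produces it), the
normalisation tilt is the quadratic form of the covariance displacement `E_P` in the normalisation's variables `B₀(y)`.
HYPOTHESES: reference one-run data WITH ROOM, displacement sizes and potential term rates LINEAR in `t = δ_op ∈ [0, 1]`,
uniform rooms / reach over `t ≤ 1`, measurability, and NOTHING about the displaced endpoint.  CONCLUSION: the `hslot`
shape of `T4ActivityThreshold.activityLipschitz₂_of_termSlots` for this term, moduli explicit. -/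

/-- [folklore] **THE PER-TERM SLOT OF THE REACH** (composition of `norm_diffForm_le_of_reach_linear`,
`opDom_of_reach_linear`, `T4ActivityTilt.dom₀_of_entryBound` and `twoSpecies_of_reach_affine`; every hypothesis a binder,
none on the displaced endpoint). -/
theorem termSlot_of_reach [DecidableEq ι] [DecidableEq κ] [DecidableEq 𝒞] [MeasurableSpace Ω] [MeasurableSpace Ω₀]
    (d : S → S → ℝ) (hd0 : ∀ s t, 0 ≤ d s t) (hsymm : ∀ s t, d s t = d t s)
    (htri : ∀ s t w, d s w ≤ d s t + d t w) (p : ι → S) (q : κ → S)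
    (LB EL : κ → ι → ℂ) (AB EA : Matrix ι ι ℂ)
    (hdB : ∀ u : ℝ, IsUnit (((u ^ 2 : ℝ) : ℂ) • (1 : Matrix ι ι ℂ) + AB).det)
    (PB EP : Matrix κ κ ℂ) (hB : IsUnit PB.det)
    (R₁ : ι → ι → ℂ) (R₂ : κ → κ → ℂ) (R₃ : κ → ι → ℂ)
    (D : Finset 𝒴) (bonds : 𝒴 → Finset κ) (cubes : 𝒴 → Finset 𝒞) (cubes₀ : Finset 𝒞) (τ : 𝒴 → ℂ)
    (Qd : Ω → 𝒴 → κ → κ → ℂ) (Rd : Ω → 𝒴 → ℂ) (w : 𝒴 → ℝ) (kk : κ → κ → ℝ) (v : 𝒴 → ℝ)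
    (ν : Measure Ω) (F : Ω → E) (Xf : Ω → ι → ℝ) (Bf : Ω → κ → ℝ) (Δh : Ω → ℂ)
    (ν₀ : Measure Ω₀) (φ : Ω₀ → ℂ) (B₀f : Ω₀ → κ → ℝ)
    {m κL a c c' κA cP cP' κP δ K cG κQ κR W Kk K'' u u' M' u₀ u₀' M₀' t δh ch βh βbar : ℝ}
    -- signs
    (hm : 0 ≤ m) (hκL : 0 ≤ κL) (ha : 0 < a) (hc : 0 ≤ c) (hκA : 0 ≤ κA) (hcP : 0 ≤ cP) (hκP : 0 ≤ κP)
    (hδ : 0 ≤ δ) (hK0 : 0 ≤ K) (hκQ : 0 ≤ κQ) (hκR : 0 ≤ κR) (hW0 : 0 ≤ W) (hKk : 0 ≤ Kk) (hK''0 : 0 ≤ K'')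
    (ht0 : 0 ≤ t) (ht1 : t ≤ 1) (hβh0 : 0 ≤ βh) (hu : 0 < u) (hu₀ : 0 < u₀)
    -- reference one-run kernel data WITH ROOM; displacement sizes linear in t; reach; common constants
    (hLB : ∀ a' i, ‖LB a' i‖ ≤ m * Real.exp (-(2 * δ * d (q a') (p i))))
    (hEL : ∀ a' i, ‖EL a' i‖ ≤ κL * t * Real.exp (-(2 * δ * d (q a') (p i))))
    (hRB : ∀ v i j, ‖T4ActivityTilt.resolvent AB v i j‖
      ≤ c * lorentz a v * Real.exp (-(2 * δ * d (p i) (p j))))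
    (hEA : ∀ i j, ‖EA i j‖ ≤ κA * t * Real.exp (-(2 * δ * d (p i) (p j))))
    (hCB : ∀ a' a'', ‖(PB⁻¹) a' a''‖ ≤ cP * Real.exp (-(δ * d (q a') (q a''))))
    (hEP : ∀ a' a'', ‖EP a' a''‖ ≤ κP * t * Real.exp (-(δ * d (q a') (q a''))))
    (hsA : c * κA * K ^ 2 < 1) (hsP : cP * κP * K ^ 2 < 1)
    (hc' : c / (1 - c * κA * K ^ 2) ≤ c') (hcP' : cP / (1 - cP * κP * K ^ 2) ≤ cP')
    (hcG : ((2 * ((m + κL) * (c' * Real.sqrt a) * K) * cP'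
              * ((κL * (c' * Real.sqrt a) + (m + κL) * (c' ^ 2 * Real.sqrt a * κA * K ^ 2)) * K)
            + ((m + κL) * (c' * Real.sqrt a) * K) ^ 2 * (cP' * κP * cP' * K ^ 2)) * K ^ 2 * K + κP * K
            + (κL * (c' * Real.sqrt a) + (m + κL) * (c' ^ 2 * Real.sqrt a * κA * K ^ 2)) * K * K) ≤ cG)
    (hR₁ : ∀ b b', R₁ b b' = sandwichKer (mulKer (LB + EL) (sqrtKer (AB + EA))) ((PB + EP)⁻¹ : Matrix κ κ ℂ) b b'
      - sandwichKer (mulKer LB (sqrtKer AB)) (PB⁻¹ : Matrix κ κ ℂ) b b')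
    (hR₂ : ∀ a' a'', R₂ a' a'' = EP a' a'')
    (hR₃ : ∀ a' b, R₃ a' b = mulKer (LB + EL) (sqrtKer (AB + EA)) a' b - mulKer LB (sqrtKer AB) a' b)
    (hKι : ∀ s, ∑ b, Real.exp (-(δ / 8 * d s (p b))) ≤ K)
    (hKκ : ∀ s, ∑ a', Real.exp (-(δ / 8 * d s (q a'))) ≤ K)
    -- the potential channel's term rates, linear in t (difference kernels may depend on the integration point)
    (hQ : ∀ x, ∀ Y ∈ D, ∀ b ∈ bonds Y, ∀ b' ∈ bonds Y, ‖τ Y * Qd x Y b b'‖ ≤ κQ * t * (w Y * kk b b'))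
    (hw : ∀ Y ∈ D, 0 ≤ w Y) (hk : ∀ b b', 0 ≤ kk b b')
    (hW : ∀ b, ∑ Y ∈ D.filter (fun Y => b ∈ bonds Y), w Y ≤ W)
    (hrow : ∀ b, ∑ b', kk b b' ≤ Kk) (hcol : ∀ b', ∑ b, kk b b' ≤ Kk)
    (hR : ∀ x, ∀ Y ∈ D, ‖τ Y * Rd x Y‖ ≤ κR * t * v Y) (hv : ∀ Y ∈ D, 0 ≤ v Y)
    (hmeet : ∀ Y ∈ D, ∃ c ∈ cubes₀, c ∈ cubes Y)
    (hpin : ∀ c ∈ cubes₀, ∑ Y ∈ D.filter (fun Y => c ∈ cubes Y), v Y ≤ K'')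
    -- the history channel and the uniform bound of the constant parts of the tilt
    (hdomh : ∀ x, ‖Δh x‖ ≤ βh) (hβhc : βh ≤ ch * δh) (hβbar : κR * (cubes₀.card * K'') * t + βh ≤ βbar)
    -- rooms and reach, uniform over t ≤ 1
    (huu' : u + (cG + κQ * W * Kk) ≤ u') (hu₀u₀' : u₀ + κP * K ≤ u₀')
    (hreach : 2 * (κP * K / (Real.exp 1 * u₀) * (M₀' + M₀')) ≤ ‖∫ y, φ y ∂ν₀‖)
    -- reference measure-side data (integrability, measurability, majorants WITH ROOM, normalisation ≠ 0)
    (hF : Integrable F ν)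
    (hΔopm : AEStronglyMeasurable
      (fun x => diffForm R₁ R₂ R₃ (Xf x) (Bf x) + potSum D bonds τ (Qd x) (Rd x) (Bf x)) ν)
    (hΔhm : AEStronglyMeasurable Δh ν) (hPm : AEStronglyMeasurable (fun x => domForm (Xf x) (Bf x)) ν)
    (hI' : Integrable (fun x => Real.exp (u' * domForm (Xf x) (Bf x)) * ‖F x‖) ν)
    (hM' : ∫ x, Real.exp (u' * domForm (Xf x) (Bf x)) * ‖F x‖ ∂ν ≤ M')
    (hφ : Integrable φ ν₀)
    (hΔ₀m : AEStronglyMeasurable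
      (fun y => (1 / 2 : ℂ) * ∑ a, ∑ a', (B₀f y a : ℂ) * EP a a' * (B₀f y a' : ℂ)) ν₀)
    (hP₀m : AEStronglyMeasurable (fun y => (∑ a, B₀f y a ^ 2) / 2) ν₀)
    (hI0' : Integrable (fun y => Real.exp (u₀' * ((∑ a, B₀f y a ^ 2) / 2)) * ‖φ y‖) ν₀)
    (hM0' : ∫ y, Real.exp (u₀' * ((∑ a, B₀f y a ^ 2) / 2)) * ‖φ y‖ ∂ν₀ ≤ M₀')
    (hzB : (∫ y, φ y ∂ν₀) ≠ 0) :
    (∫ y, Complex.exp (-((1 / 2 : ℂ) * ∑ a, ∑ a', (B₀f y a : ℂ) * EP a a' * (B₀f y a' : ℂ))) • φ y ∂ν₀) ≠ 0 ∧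
    ‖(∫ y, Complex.exp (-((1 / 2 : ℂ) * ∑ a, ∑ a', (B₀f y a : ℂ) * EP a a' * (B₀f y a' : ℂ))) • φ y ∂ν₀)⁻¹
          • (∫ x, Complex.exp (-((diffForm R₁ R₂ R₃ (Xf x) (Bf x) + potSum D bonds τ (Qd x) (Rd x) (Bf x))
              + Δh x)) • F x ∂ν)
        - (∫ y, φ y ∂ν₀)⁻¹ • (∫ x, F x ∂ν)‖
      ≤ ((cG + κQ * W * Kk + Real.exp 1 * u * (κR * (cubes₀.card * K'')))
              * (2 + 4 * (κP * K) * M₀' / (Real.exp 1 * u₀ * ‖∫ y, φ y ∂ν₀‖))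
              / (Real.exp 1 * u) + 4 * (κP * K) * M₀' / (Real.exp 1 * u₀ * ‖∫ y, φ y ∂ν₀‖))
            * (2 * Real.exp βbar * M' / ‖∫ y, φ y ∂ν₀‖) * t
          + ch * (2 + 4 * (κP * K) * M₀' / (Real.exp 1 * u₀ * ‖∫ y, φ y ∂ν₀‖))
            * (2 * Real.exp βbar * M' / ‖∫ y, φ y ∂ν₀‖) * δh := by
  -- constants
  have hden : 0 < 1 - c * κA * K ^ 2 := by linarith
  have hdenP : 0 < 1 - cP * κP * K ^ 2 := by linarith
  have hc'0 : 0 ≤ c' := le_trans (div_nonneg hc hden.le) hc'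
  have hcP'0 : 0 ≤ cP' := le_trans (div_nonneg hcP hdenP.le) hcP'
  have hcG0 : 0 ≤ cG := le_trans (by positivity) hcG
  have hM0'0 : 0 ≤ M₀' := le_trans (integral_nonneg fun y => by positivity) hM0'
  -- the Gaussian channel, pointwise, linear in t (§15.2)
  have hG : ∀ x, ‖diffForm R₁ R₂ R₃ (Xf x) (Bf x)‖ ≤ cG * t * domForm (Xf x) (Bf x) := fun x =>
    (norm_diffForm_le_of_reach_linear d hd0 hsymm htri p q LB EL AB EA hdB PB EP hB R₁ R₂ R₃ hm hκL ha hc hκA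
      hcP hκP hδ hK0 ht0 ht1 hLB hEL hRB hEA hCB hEP hsA hsP hc' hcP' hR₁ hR₂ hR₃ hKι hKκ (Xf x) (Bf x)).trans
      (mul_le_mul_of_nonneg_right (mul_le_mul_of_nonneg_right hcG ht0) (domForm_nonneg _ _))
  -- the operator channel (§15.3)
  have hdomop : ∀ x, ‖diffForm R₁ R₂ R₃ (Xf x) (Bf x) + potSum D bonds τ (Qd x) (Rd x) (Bf x)‖
      ≤ ((cG + κQ * W * Kk) * t) * domForm (Xf x) (Bf x) + (κR * (cubes₀.card * K'')) * t := fun x =>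
    opDom_of_reach_linear D bonds cubes cubes₀ τ (Qd x) (Rd x) w kk v (Xf x) (Bf x) hκQ hκR ht0 hW0 hKk (hG x)
      (hQ x) hw hk hW hrow hcol (hR x) hv hmeet hpin
  -- the normalisation tilt dominated (Schur, `dom₀_of_entryBound`)
  have hrow₂ : ∀ a, ∑ a', Real.exp (-(δ * d (q a) (q a'))) ≤ K := fun a =>
    latticeSum_mono d hd0 q (by linarith) hKκ (q a)
  have hcol₂ : ∀ a', ∑ a, Real.exp (-(δ * d (q a) (q a'))) ≤ K := fun a' => by
    calc ∑ a, Real.exp (-(δ * d (q a) (q a'))) = ∑ a, Real.exp (-(δ * d (q a') (q a))) :=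
          Finset.sum_congr rfl fun a _ => by rw [hsymm (q a) (q a')]
      _ ≤ K := hrow₂ a'
  have hdom₀ : ∀ y, ‖(1 / 2 : ℂ) * ∑ a, ∑ a', (B₀f y a : ℂ) * EP a a' * (B₀f y a' : ℂ)‖
      ≤ (κP * t * K) * ((∑ a, B₀f y a ^ 2) / 2) := fun y =>
    dom₀_of_entryBound EP (fun a a' => Real.exp (-(δ * d (q a) (q a')))) (by positivity) hEP
      (fun _ _ => (Real.exp_pos _).le) hrow₂ hcol₂ (B₀f y)
  -- rooms and reach at the actual sizes
  have hρle : (cG + κQ * W * Kk) * t ≤ cG + κQ * W * Kk := mul_le_of_le_one_right (by positivity) ht1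
  have hρ₀le : κP * t * K ≤ κP * K := by
    have : κP * t * K = (κP * K) * t := by ring
    rw [this]; exact mul_le_of_le_one_right (by positivity) ht1
  have hreach' : 2 * (κP * t * K / (Real.exp 1 * u₀) * (M₀' + M₀')) ≤ ‖∫ y, φ y ∂ν₀‖ := by
    refine le_trans ?_ hreach
    have he : 0 < Real.exp 1 * u₀ := mul_pos (Real.exp_pos 1) hu₀
    gcongr
  have h := twoSpecies_of_reach_affine ν F
    (fun x => diffForm R₁ R₂ R₃ (Xf x) (Bf x) + potSum D bonds τ (Qd x) (Rd x) (Bf x)) Δh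
    (fun x => domForm (Xf x) (Bf x)) ν₀ φ
    (fun y => (1 / 2 : ℂ) * ∑ a, ∑ a', (B₀f y a : ℂ) * EP a a' * (B₀f y a' : ℂ))
    (fun y => (∑ a, B₀f y a ^ 2) / 2)
    (ρ := (cG + κQ * W * Kk) * t) (βop := κR * (cubes₀.card * K'') * t) (ρ₀ := κP * t * K)
    (cρ := cG + κQ * W * Kk) (cβ := κR * (cubes₀.card * K'')) (c₀ := κP * K) (ch := ch) (δh := δh)
    (βbar := βbar)
    (by positivity) (by positivity) hβh0 hu (by linarith) hdomop hdomh (fun x => domForm_nonneg _ _) hF hΔopm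
    hΔhm hPm hI' hM' (by positivity) hu₀ (by linarith) hdom₀ (fun y => by positivity) hφ hΔ₀m hP₀m hI0' hM0'
    hzB hreach' ht0 ht1 (by positivity) le_rfl le_rfl (le_of_eq (by ring)) hβhc hβbar
  exact h

/-! ## §15.6 Toy: the (DOM) of the reach on the `2 × 2` toy of `T4ActivityTilt` §10.1 [folklore]

`ι = κ = S = Fin 2`, `d = d2`, reference kernels `L_B = A_B = P_B = A_1 = 𝟙`, all three displacements
`E = A_{1+t} − A_1 = t·𝟙`, `m = c = a = c_P = 1`, `r_L = r = r_P = |t|`, `δ = 1`, lattice sums `≤ 2` at every rate: for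
`|t| < 1/4` every hypothesis of `norm_diffForm_le_of_reach` is discharged on concrete complex data (`toy_dom_of_reach`);
NO datum of the displaced run `A_{1+t}` is supplied. -/

namespace Toy

open Literature.MathematicalPhysics.QuantumFieldTheory.Balaban1983to89.T4ActivityTilt.Toy
  (d2 d2_nonneg d2_symm d2_triangle Ad Ad_apply Ad_inv isUnit_Ad_det isUnit_shift_Ad_det norm_resolvent_Ad_le
    norm_Ad_sub_le)

/-- [folklore] (toy) lattice sums of the two-point lattice at any rate are `≤ 2`. -/
theorem sum_d2_le_two {σ : ℝ} (hσ : 0 ≤ σ) (s : Fin 2) : ∑ a, Real.exp (-(σ * d2 s a)) ≤ 2 := by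
  have h1 : ∀ a, Real.exp (-(σ * d2 s a)) ≤ 1 := fun a =>
    Real.exp_le_one_iff.mpr (by have := d2_nonneg s a; nlinarith)
  calc ∑ a, Real.exp (-(σ * d2 s a)) ≤ ∑ _a : Fin 2, (1 : ℝ) := Finset.sum_le_sum fun a _ => h1 a
    _ = 2 := by simp

/-- [folklore] (toy) the reference kernel `A_1 = 𝟙` decays at every rate with constant `1`. -/
theorem norm_Ad_one_le (σ : ℝ) (i j : Fin 2) : ‖Ad 1 i j‖ ≤ 1 * Real.exp (-(σ * d2 i j)) := by
  rw [Ad_apply]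
  unfold d2
  split_ifs with h
  · simp
  · rw [norm_zero]; positivity

/-- [folklore] (toy) the displacement `A_{1+t} − A_1 = t·𝟙` decays at every rate with constant `|t|`. -/
theorem norm_E_le (t σ : ℝ) (i j : Fin 2) :
    ‖(Ad (1 + t) - Ad 1) i j‖ ≤ |t| * Real.exp (-(σ * d2 i j)) := by
  rw [Matrix.sub_apply, Ad_apply, Ad_apply]
  unfold d2
  split_ifs with h
  · simp only [mul_zero, neg_zero, Real.exp_zero, mul_one]
    push_cast
    rw [show (1 : ℂ) + (t : ℂ) - 1 = (t : ℂ) by ring, Complex.norm_real, Real.norm_eq_abs]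
  · rw [sub_zero, norm_zero]; positivity

/-- [folklore] (toy) **every hypothesis of `norm_diffForm_le_of_reach` inhabited** on the `2 × 2` toy with NO datum of
the displaced run: for `|t| < 1/4` the three difference kernels of the runs `A_{1+t}` vs `A_1` (composite
`L·A^{−1/2}`-sandwich, covariance, mixed) obey a linear form domination. -/
theorem toy_dom_of_reach {t : ℝ} (ht : |t| < 1 / 4) :
    ∃ ρ : ℝ, ∀ (X B : Fin 2 → ℝ),
      ‖diffForm
          (fun b b' => sandwichKer (mulKer (Ad 1 + (Ad (1 + t) - Ad 1)) (sqrtKer (Ad 1 + (Ad (1 + t) - Ad 1))))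
              ((Ad 1 + (Ad (1 + t) - Ad 1))⁻¹ : Matrix (Fin 2) (Fin 2) ℂ) b b'
            - sandwichKer (mulKer (Ad 1) (sqrtKer (Ad 1))) ((Ad 1)⁻¹ : Matrix (Fin 2) (Fin 2) ℂ) b b')
          (fun a' a'' => (Ad (1 + t) - Ad 1) a' a'')
          (fun a' b => mulKer (Ad 1 + (Ad (1 + t) - Ad 1)) (sqrtKer (Ad 1 + (Ad (1 + t) - Ad 1))) a' b
            - mulKer (Ad 1) (sqrtKer (Ad 1)) a' b) X B‖
        ≤ ρ * domForm X B := by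
  have hs : 1 * |t| * (2 : ℝ) ^ 2 < 1 := by nlinarith [abs_nonneg t]
  have hinv : ∀ a' a'' : Fin 2, ‖((Ad 1)⁻¹ : Matrix (Fin 2) (Fin 2) ℂ) a' a''‖ ≤ 1 * Real.exp (-(1 * d2 a' a'')) :=
    fun a' a'' => by rw [Ad_inv one_ne_zero, div_one]; exact norm_Ad_one_le 1 a' a''
  exact ⟨_, fun X B => norm_diffForm_le_of_reach (S := Fin 2) d2 d2_nonneg d2_symm d2_triangle id id
    (Ad 1) (Ad (1 + t) - Ad 1) (Ad 1) (Ad (1 + t) - Ad 1) (fun u => isUnit_shift_Ad_det one_pos u)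
    (Ad 1) (Ad (1 + t) - Ad 1) (isUnit_Ad_det one_ne_zero) _ _ _
    (m := 1) (mb := 1 + |t|) (rL := |t|) (a := 1) (c := 1) (c' := 1 / (1 - 1 * |t| * 2 ^ 2)) (r := |t|)
    (cP := 1) (cP' := 1 / (1 - 1 * |t| * 2 ^ 2)) (rP := |t|) (δ := 1) (K := 2)
    zero_le_one (abs_nonneg t) le_rfl one_pos zero_le_one (abs_nonneg t) zero_le_one (abs_nonneg t)
    zero_le_one (by norm_num)
    (fun a' i => norm_Ad_one_le (2 * 1) a' i) (fun a' i => norm_E_le t (2 * 1) a' i)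
    (fun v i j => by rw [show (2 : ℝ) * 1 = 2 from mul_one 2]; exact norm_resolvent_Ad_le le_rfl v i j)
    (fun i j => norm_E_le t (2 * 1) i j) hinv (fun a' a'' => norm_E_le t 1 a' a'')
    hs hs le_rfl le_rfl (fun _ _ => rfl) (fun _ _ => rfl) (fun _ _ => rfl)
    (sum_d2_le_two (by norm_num)) (sum_d2_le_two (by norm_num)) X B⟩

end Toy

end Literature.MathematicalPhysics.QuantumFieldTheory.Balaban1983to89.T4ActivityTermReach
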